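import Summits.CriticalPhenomena.PercolationContinuityZ3.Theorems.PercNearOneGluingNoHeavyLowerTailCSHPsiTheoremOne
import Literature.Probability.Percolation.KozmaNitzanPreFKG
import HarnessLib

/-!
# Conditioned gluing (lane prim-rate, constants-miner 1, rows M1-C1 / M1-C2): Kozma–Nitzan's (3) and Conjecture-1 event form
# conditioned on an increasing connection of the observer — for EVERY relay set, non-degenerate weights

Support file for the closed crux `AdditiveGluing` family (stmt-CriticalPhenomena-4576, `--as helper`).  The prim-rate miner's census rows
M1-C2 (`μ(o↔c', o↔A, o↮b) ≤ max_{a∈A} μ(o↔c', o↔A, a↮b)`) and M1-C1 (`μ(o↔c', o↔A, o↮b) ≤ max_a μ(a↮b) · μ(o↔c', o↔A)`), census-clean on all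
graphs with ≤ 6 vertices and proved for `|A| = 2` and ALL weights in `PercNearOneGluingNoHeavyPairObserverPreFKG.lean`, are in fact
COROLLARIES, for all `|A|` and all NON-DEGENERATE weights `0 < w < 1`, of the tree's event-refined Question 7
`PinCSH.question7_refined` (fat-minority line, `…CSHPsiTheoremOne.lean`): take the increasing cluster event `E = {C_o ∋ c'} = {o ↔ c'}`
(`𝓗 = KNPreFKG.connFamily o c'`).  No definitions, no named facts, no sorries.

* `CondGluingAll.condPreFKGGluing` — M1-C2 for every relay set (`o ∉ A`, `0 < w < 1`).
* `CondGluingAll.condEventGluing` — M1-C1 for every relay set (`o ∉ A`, `0 < w < 1`), by Harris.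
(Degenerate weights / `o ∈ A`: `o ∈ A` is trivial (take `a = o`); weights in `{0,1}` follow by the tree's weight-closure arguments and are
not restated here — the `|A| = 2` file covers all weights.)
[cite: KozmaNitzan2024, display (3) (p. 3), Question 7 (p. 36), (41) (p. 33)]
-/

noncomputable section

namespace Summit.CriticalPhenomena.PercolationContinuityZ3.Theorems

open MeasureTheory Set
open Literature.Probability.LatticeModels (prodBernoulli)
open Literature.Probability.Percolation
open Literature.Probability.Percolation.KNPreFKG
open scoped Classical

namespace CondGluingAll

variable {n : ℕ}

/-- The conditioning event `{o ↔ c'}` is the increasing open-edge-cluster event `{C_o ∈ connFamily o c'}`. [folklore] -/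
theorem setOf_connFamily_eq (o c' : Fin n) :
    {ω : BondConfig (Fin n) | openEdgeCluster ω o ∈ connFamily o c'} = (openConn o c' : Set (BondConfig (Fin n))) :=
  (openConn_eq_setOf_connFamily o c').symm

/-- **M1-C2 for every relay set (non-degenerate weights): Kozma–Nitzan's (3) conditioned on `{o ↔ c'}`.**  For `0 < w < 1`, `o ∉ A`:
if `μ({o↔c'} ∩ {o↔A} ∩ {a ↮ b}) ≤ m` for every `a ∈ A` then `μ({o↔c'} ∩ {o↔A} ∩ {o ↮ b}) ≤ m`.
Proof: `PinCSH.question7_refined` with `E = {o ↔ c'}` and the relay `c ∈ A` minimising `μ(c ↔ b)` gives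
`μ(c↔b, E, o↔A) ≤ μ(o↔b, E, o↔A)`; complement inside `E ∩ {o↔A}`. [cite: KozmaNitzan2024, Question 7 (p. 36), display (3) (p. 3)] -/
theorem condPreFKGGluing (w : Sym2 (Fin n) → unitInterval) (hw : ∀ e, 0 < w e ∧ w e < 1)
    (A : Finset (Fin n)) (hA : A.Nonempty) (o b c' : Fin n) (hoA : o ∉ A) (m : ℝ)
    (hm : ∀ a ∈ A, (prodBernoulli w).real ((openConn o c' ∩ ⋃ a' ∈ A, openConn o a') ∩
        (openConn a b : Set (BondConfig (Fin n)))ᶜ) ≤ m) :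
    (prodBernoulli w).real ((openConn o c' ∩ ⋃ a ∈ A, openConn o a) ∩ (openConn o b : Set (BondConfig (Fin n)))ᶜ) ≤ m := by
  classical
  set μ := prodBernoulli w with hμ
  have hmeas : ∀ S : Set (BondConfig (Fin n)), MeasurableSet S := fun _ => MeasurableSet.of_discrete
  set G : Set (BondConfig (Fin n)) := openConn o c' ∩ ⋃ a ∈ A, openConn o a with hG
  -- the designated relay: `c ∈ A` minimising `μ(c ↔ b)`
  obtain ⟨c, hcA, hcmin⟩ := Finset.exists_min_image A (fun a => μ.real (openConn a b : Set (BondConfig (Fin n)))) hA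
  have hq7 := PinCSH.question7_refined w hw o (connFamily o c') (isUpperSet_connFamily o c') b A c hoA hcA
    (fun a ha => hcmin a ha)
  rw [setOf_connFamily_eq] at hq7
  -- complement inside `G`
  have hsplit : ∀ S : Set (BondConfig (Fin n)), μ.real G = μ.real (S ∩ G) + μ.real (G ∩ Sᶜ) := by
    intro S
    rw [inter_comm S G, ← measureReal_inter_add_sdiff (s := G) (hmeas S), Set.sdiff_eq]
  have h1 := hsplit (openConn o b)
  have h2 := hsplit (openConn c b)
  have hc := hm c hcA
  linarith

/-- **M1-C1 for every relay set (non-degenerate weights): Conjecture 1's event form conditioned on `{o ↔ c'}`.**  For `0 < w < 1`,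
`o ∉ A`, `A ≠ ∅` and `μ(a ↮ b) ≤ s` on `A`:  `μ({o↔c'} ∩ {o↔A} ∩ {o ↮ b}) ≤ s · μ({o↔c'} ∩ {o↔A})`.  From `condPreFKGGluing` and Harris
(`{o↔c'} ∩ {o↔A}` increasing, `{a ↮ b}` decreasing). [cite: KozmaNitzan2024, Conj. 1 (p. 3), Question 7 (p. 36)] -/
theorem condEventGluing (w : Sym2 (Fin n) → unitInterval) (hw : ∀ e, 0 < w e ∧ w e < 1)
    (A : Finset (Fin n)) (hA : A.Nonempty) (o b c' : Fin n) (hoA : o ∉ A) (s : ℝ)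
    (hs : ∀ a ∈ A, (prodBernoulli w).real (openConn a b : Set (BondConfig (Fin n)))ᶜ ≤ s) :
    (prodBernoulli w).real ((openConn o c' ∩ ⋃ a ∈ A, openConn o a) ∩ (openConn o b : Set (BondConfig (Fin n)))ᶜ) ≤
      s * (prodBernoulli w).real (openConn o c' ∩ ⋃ a ∈ A, openConn o a : Set (BondConfig (Fin n))) := by
  classical
  set μ := prodBernoulli w with hμ
  set G : Set (BondConfig (Fin n)) := openConn o c' ∩ ⋃ a ∈ A, openConn o a with hG
  have hmeas : ∀ S : Set (BondConfig (Fin n)), MeasurableSet S := fun _ => MeasurableSet.of_discrete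
  have hGup : IsUpperSet G := by
    refine (isUpperSet_openConn o c').inter ?_
    intro ω ω' hle hω
    simp only [mem_iUnion, exists_prop] at hω ⊢
    obtain ⟨a, ha, hωa⟩ := hω
    exact ⟨a, ha, isUpperSet_openConn o a hle hωa⟩
  have hG0 : 0 ≤ μ.real G := measureReal_nonneg
  have hb : ∀ a ∈ A, μ.real (G ∩ (openConn a b : Set (BondConfig (Fin n)))ᶜ) ≤ s * μ.real G := by
    intro a ha
    calc μ.real (G ∩ (openConn a b : Set (BondConfig (Fin n)))ᶜ)
        ≤ μ.real G * μ.real (openConn a b : Set (BondConfig (Fin n)))ᶜ :=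
          Literature.Probability.LatticeModels.prodBernoulli_harris_upper_lower w hGup
            (isUpperSet_openConn a b).compl (hmeas _) (hmeas _)
      _ ≤ μ.real G * s := mul_le_mul_of_nonneg_left (hs a ha) hG0
      _ = s * μ.real G := mul_comm _ _
  exact condPreFKGGluing w hw A hA o b c' hoA (s * μ.real G) hb

end CondGluingAll

end Summit.CriticalPhenomena.PercolationContinuityZ3.Theorems

end
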